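import Mathlib
import Literature.NumberTheory.LFunctions.Zhang2022.Section11XiZeroTrueSize
import HarnessLib

/-!
# Zhang (2022) §§7, 11, 12: an exponent-one majorant of `ξ₀ⱼ(n;d,r)` with divisor structure,
# and its three means

Topic `Literature/NumberTheory/LFunctions/Zhang2022` (Landau–Siegel audit tree; verdict-neutral).
Y. Zhang, *Discrete mean estimates and the Landau–Siegel zero*, arXiv:2211.02515v1 (2022)
[Zhang2022LandauSiegel], §7 p. 33 (Prop. 7.1: `λ₀ⱼ`, `κ̃₀ⱼ`, `ξ₀ⱼ(n;d,r)`), §11 p. 64 and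
§12 p. 67 ("… by (8.25), (8.26) and simple estimates") — **an unrefereed manuscript under
adjudication; nothing here asserts or denies its Theorems 1–2** (ZHANG-L discharge lane,
WP11/WP12: the absolute-value bound for `S_j` on window-supported sequences).

The companion file `Section12SjWindowEngine` needs a majorant `G ≥ 0` of `|ξ₀ⱼ(n;d,r)|`,
INDEPENDENT of `d, r`, with the three means `Σ_{n≤X} G(n) ≤ AX`, `Σ_{n≤X} G(n)/n ≤ A(1+log X)`,
`Σ_{n≤X} G(n)/√n ≤ A√X`. This file builds it with DIVISOR STRUCTURE, `G = ζ ∗ g`: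

* `gS` — the multiplicative seed with `g(q) = 21B log q + M_x/q` at primes (`B = |b₁|+|b₂|+|b₃|`,
  `M_x = 12 + 56S₃`) and `g(q^ν) = C_x(ν+1)⁴` at higher prime powers; `GS = ζ ∗ gS`, so
  `GS(q) = 1 + 21B log q + M_x/q` — the TRUE SIZE of `|ξ₀ⱼ(q;d,r)|` for `q ∤ r`
  (`XiZeroMajorant.norm_xiZero_prime_le_of_not_dvd`, the `μ`-cancellation inside the local
  factor; Section11XiZeroTrueSize), and `GS(q^ν) ≥ gC(q^ν) ≥ |ξ₀ⱼ(q^ν;d,r)|`;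
* `norm_xiZero_le_two_pow_mul_GS` — **`|ξ₀ⱼ(n;d,r)| ≤ 2^{ω(r)}·GS(n)`** for `n, d, r ≥ 1`
  (multiplicativity of `ξ₀ⱼ` in `n`, `Lemma83.xiZero_mul_of_coprime`; the primes `q ∣ r` cost a
  factor `2` each);
* `sum_gS_div_le` — `Σ_{e≤X} gS(e)/e ≤ exp(21B·log 4X + M_x + C_xS₄)` (log-mean EXPONENT ZERO,
  `XiZeroMajorant.sum_div_le_gen`), whence, by `Σ_{n≤X}(ζ∗g)(n)w(n) = Σ_e g(e)Σ_{m≤X/e} w(em)`,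
  the three means of `GS` with `A = 2·exp(…)` (`sum_GS_le`, `sum_GS_div_le`,
  `sum_GS_div_sqrt_le`), and for `D ≥ D₀(c′)`, `X ≤ 16P` an ABSOLUTE `A` (`GS_means_ell`).

No statement about the manuscript's Theorems 1–2 or about Landau–Siegel zeros is made or implied.

## References

* Y. Zhang, arXiv:2211.02515v1 (2022), §7 p. 33; §11 p. 64; §12 p. 67.
  [cite: Zhang2022LandauSiegel, §7 p.33; §11 p.64; §12 p.67]
* R. R. Hall, G. Tenenbaum, *Divisors* (CUP 1988), (0.4). [cite: HallTenenbaum1988, (0.4)]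
-/

noncomputable section

open Finset Real ArithmeticFunction
open scoped ArithmeticFunction.zeta

namespace Literature.NumberTheory.LFunctions.Zhang2022.XiZeroMajorant

open MeanSquareMajorant

variable (c' : ℝ) (D : ℕ)

/-! ### Part 1. The seed `gS` and the majorant `GS = ζ ∗ gS` -/

/-- The constant `M_x = 12 + 56S₃` of the prime bound `|ξ₀ⱼ(q;d,r)| ≤ 1 + 21B log q + M_x/q`.
[cite: Zhang2022LandauSiegel, §7 p.33] -/
def Mx : ℝ := 12 + 56 * LogEulerProduct.tailConst 3

/-- The prime-power constant `C_x = 7(2+S₃) + 75π + M_x` of the seed. [cite: Zhang2022LandauSiegel, §7 p.33] -/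
def Cx : ℝ := 7 * (2 + LogEulerProduct.tailConst 3) + 75 * π + Mx

/-- `0 ≤ M_x`. [cite: Zhang2022LandauSiegel, §7 p.33] -/
theorem Mx_nonneg' : 0 ≤ Mx := by
  unfold Mx; linarith [LogEulerProduct.tailConst_nonneg 3]

/-- `7(2+S₃) ≤ C_x`, `75π + M_x ≤ C_x`, `0 ≤ C_x`. [cite: Zhang2022LandauSiegel, §7 p.33] -/
theorem Cx_bounds : 7 * (2 + LogEulerProduct.tailConst 3) ≤ Cx ∧ 75 * π + Mx ≤ Cx ∧ 0 ≤ Cx := by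
  have h3 := LogEulerProduct.tailConst_nonneg 3
  have hM := Mx_nonneg'
  have hπ := Real.pi_pos.le
  unfold Cx
  exact ⟨by nlinarith, by nlinarith, by nlinarith⟩

/-- The local values of the seed: `g(q) = 21B log q + M_x/q`, `g(q^ν) = C_x(ν+1)⁴` (`ν ≥ 2`).
[cite: Zhang2022LandauSiegel, §7 p.33] -/
def gloc (q ν : ℕ) : ℝ :=
  if ν = 1 then 21 * Bsum c' D * Real.log q + Mx / q else Cx * ((ν : ℝ) + 1) ^ 4

/-- **The seed `gS`**: the multiplicative function with local values `gloc` (`gS 0 = 0`).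
[cite: Zhang2022LandauSiegel, §7 p.33] -/
def gS : ArithmeticFunction ℝ :=
  ⟨fun n => if n = 0 then 0 else n.factorization.prod (gloc c' D), if_pos rfl⟩

/-- `gS n` for `n ≠ 0`. [cite: Zhang2022LandauSiegel, §7 p.33] -/
theorem gS_apply {n : ℕ} (hn : n ≠ 0) : gS c' D n = n.factorization.prod (gloc c' D) := by
  simp [gS, hn]

/-- `0 ≤ gloc q ν`. [cite: Zhang2022LandauSiegel, §7 p.33] -/
theorem gloc_nonneg (q ν : ℕ) : 0 ≤ gloc c' D q ν := by
  unfold gloc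
  split_ifs
  · have hB := Bsum_nonneg c' D
    have hlog : 0 ≤ Real.log q := Real.log_natCast_nonneg q
    have hM := Mx_nonneg'
    positivity
  · have := Cx_bounds.2.2; positivity

/-- `0 ≤ gS n`. [cite: Zhang2022LandauSiegel, §7 p.33] -/
theorem gS_nonneg (n : ℕ) : 0 ≤ gS c' D n := by
  by_cases hn : n = 0
  · simp [gS, hn]
  · rw [gS_apply c' D hn, Finsupp.prod]
    exact prod_nonneg fun q _ => gloc_nonneg c' D _ _

/-- `gS` is multiplicative. [cite: Zhang2022LandauSiegel, §7 p.33] -/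
theorem isMultiplicative_gS : (gS c' D).IsMultiplicative := by
  rw [IsMultiplicative.iff_ne_zero]
  refine ⟨by simp [gS], fun {m n} hm hn hmn => ?_⟩
  rw [gS_apply c' D (mul_ne_zero hm hn), gS_apply c' D hm, gS_apply c' D hn,
    Nat.factorization_mul hm hn,
    Finsupp.prod_add_index_of_disjoint (Nat.Coprime.disjoint_primeFactors hmn |>.mono
      (by rw [Nat.support_factorization]) (by rw [Nat.support_factorization]))]

/-- At a prime power: `gS(q^ν) = gloc q ν` (`ν ≥ 1`). [cite: Zhang2022LandauSiegel, §7 p.33] -/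
theorem gS_prime_pow {q : ℕ} (hq : q.Prime) {ν : ℕ} (hν : ν ≠ 0) :
    gS c' D (q ^ ν) = gloc c' D q ν := by
  rw [gS_apply c' D (pow_ne_zero ν hq.ne_zero), hq.factorization_pow, Finsupp.prod,
    Finsupp.support_single _ hν, prod_singleton, Finsupp.single_eq_same]

/-- `gS(q) = 21B log q + M_x/q` at a prime. [cite: Zhang2022LandauSiegel, §7 p.33] -/
theorem gS_prime {q : ℕ} (hq : q.Prime) :
    gS c' D q = 21 * Bsum c' D * Real.log q + Mx / q := by
  have h := gS_prime_pow c' D hq one_ne_zero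
  rw [pow_one] at h
  rw [h, gloc, if_pos rfl]

/-- `gS(q^ν) = C_x(ν+1)⁴` for `ν ≥ 2`. [cite: Zhang2022LandauSiegel, §7 p.33] -/
theorem gS_prime_pow_two_le {q : ℕ} (hq : q.Prime) {ν : ℕ} (hν : 2 ≤ ν) :
    gS c' D (q ^ ν) = Cx * ((ν : ℝ) + 1) ^ 4 := by
  rw [gS_prime_pow c' D hq (by omega), gloc, if_neg (by omega)]

/-- **The majorant `GS = ζ ∗ gS`**, `GS(n) = Σ_{e∣n} gS(e)`. [cite: Zhang2022LandauSiegel, §7 p.33] -/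
def GS : ArithmeticFunction ℝ := (ζ : ArithmeticFunction ℝ) * gS c' D

/-- `GS(n) = Σ_{e ∣ n} gS(e)`. [cite: Zhang2022LandauSiegel, §7 p.33] -/
theorem GS_apply (n : ℕ) : GS c' D n = ∑ e ∈ n.divisors, gS c' D e := by
  rw [GS, coe_zeta_mul_apply]

/-- `GS` is multiplicative. [cite: Zhang2022LandauSiegel, §7 p.33] -/
theorem isMultiplicative_GS : (GS c' D).IsMultiplicative :=
  isMultiplicative_zeta.natCast.mul (isMultiplicative_gS c' D)

/-- `0 ≤ GS n`. [cite: Zhang2022LandauSiegel, §7 p.33] -/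
theorem GS_nonneg (n : ℕ) : 0 ≤ GS c' D n := by
  rw [GS_apply]; exact sum_nonneg fun e _ => gS_nonneg c' D e

/-- At a prime power: `GS(q^ν) = Σ_{i ≤ ν} gS(q^i)`. [cite: Zhang2022LandauSiegel, §7 p.33] -/
theorem GS_prime_pow {q : ℕ} (hq : q.Prime) (ν : ℕ) :
    GS c' D (q ^ ν) = ∑ i ∈ range (ν + 1), gS c' D (q ^ i) := by
  rw [GS_apply, Nat.sum_divisors_prime_pow hq]

/-- `gS(q^ν) ≤ GS(q^ν)`. [cite: Zhang2022LandauSiegel, §7 p.33] -/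
theorem gS_le_GS_prime_pow {q : ℕ} (hq : q.Prime) (ν : ℕ) : gS c' D (q ^ ν) ≤ GS c' D (q ^ ν) := by
  rw [GS_prime_pow c' D hq, sum_range_succ]
  have : 0 ≤ ∑ i ∈ range ν, gS c' D (q ^ i) := sum_nonneg fun i _ => gS_nonneg c' D _
  linarith

/-- `GS(q) = 1 + 21B log q + M_x/q` at a prime — the true size of `|ξ₀ⱼ(q;d,r)|`, `q ∤ r`.
[cite: Zhang2022LandauSiegel, §7 p.33] -/
theorem GS_prime {q : ℕ} (hq : q.Prime) :
    GS c' D q = 1 + 21 * Bsum c' D * Real.log q + Mx / q := by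
  have h := GS_prime_pow c' D hq 1
  rw [pow_one] at h
  rw [h, sum_range_succ, sum_range_one, pow_zero, pow_one, (isMultiplicative_gS c' D).map_one,
    gS_prime c' D hq]
  ring


/-! ### Part 2. `|ξ₀ⱼ(n;d,r)| ≤ 2^{ω(r)}·GS(n)` -/

omit c' D in
/-- Comparison of multiplicative functions from prime powers: if `f, G ≥ 0` are multiplicative on
coprime arguments, `f 1 ≤ G 1`... precisely `f 1 = 1 = G 1`, and `f(q^ν) ≤ G(q^ν)` at every prime
power (`ν ≥ 1`), then `f(n) ≤ G(n)` for all `n ≥ 1`. [folklore] -/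
private theorem le_of_prime_pow_le {f G : ℕ → ℝ} (hf0 : ∀ n, 0 ≤ f n) (hG0 : ∀ n, 0 ≤ G n)
    (hf1 : f 1 = 1) (hG1 : G 1 = 1)
    (hfmul : ∀ m n, Nat.Coprime m n → f (m * n) = f m * f n)
    (hGmul : ∀ m n, Nat.Coprime m n → G (m * n) = G m * G n)
    (hpow : ∀ q ν : ℕ, q.Prime → 0 < ν → f (q ^ ν) ≤ G (q ^ ν)) {n : ℕ} (hn : n ≠ 0) :
    f n ≤ G n := by
  induction n using Nat.recOnPosPrimePosCoprime with
  | prime_pow p k hp hk => exact hpow p k hp hk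
  | zero => exact absurd rfl hn
  | one => rw [hf1, hG1]
  | coprime a b ha hb hab iha ihb =>
    rw [hfmul a b hab, hGmul a b hab]
    exact mul_le_mul (iha (by omega)) (ihb (by omega)) (hf0 b) (hG0 a)

omit c' D in
/-- `ω_r(mn) = ω_r(m) + ω_r(n)` for coprime `m, n` (`ω_r(n) = #{q ∣ n prime : q ∣ r}`). [folklore] -/
private theorem card_pf_filter_dvd_mul (r : ℕ) {m n : ℕ} (hmn : Nat.Coprime m n) (hm : m ≠ 0)
    (hn : n ≠ 0) : ((m * n).primeFactors.filter (fun q => q ∣ r)).card =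
      (m.primeFactors.filter (fun q => q ∣ r)).card + (n.primeFactors.filter (fun q => q ∣ r)).card := by
  rw [Nat.primeFactors_mul hm hn, filter_union,
    card_union_of_disjoint (disjoint_filter_filter hmn.disjoint_primeFactors)]

omit c' D in
/-- `ω_r(n) ≤ ω(r)` for `r ≠ 0`. [folklore] -/
private theorem card_pf_filter_dvd_le (n : ℕ) {r : ℕ} (hr : r ≠ 0) :
    (n.primeFactors.filter (fun q => q ∣ r)).card ≤ r.primeFactors.card := by
  refine card_le_card fun q hq => ?_
  rw [mem_filter] at hq
  exact Nat.mem_primeFactors.mpr ⟨Nat.prime_of_mem_primeFactors hq.1, hq.2, hr⟩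

omit c' D in
/-- `ω_r(q^ν) = [q ∣ r]` at a prime power (`ν ≥ 1`). [folklore] -/
private theorem card_pf_filter_dvd_prime_pow (r : ℕ) {q : ℕ} (hq : q.Prime) {ν : ℕ} (hν : ν ≠ 0) :
    ((q ^ ν).primeFactors.filter (fun p => p ∣ r)).card = if q ∣ r then 1 else 0 := by
  rw [Nat.primeFactors_prime_pow hν hq, filter_singleton]
  split_ifs <;> simp

/-- **`|ξ₀ⱼ(n;d,r)| ≤ 2^{ω(r)}·GS(n)`** for `n, d, r ≥ 1` (all `c′, D, j`): the halved function
`|ξ₀ⱼ(n;d,r)|/2^{ω_r(n)}` is multiplicative in `n` (`Lemma83.xiZero_mul_of_coprime`) and bounded at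
prime powers by `GS` (`q ∤ r`: `norm_xiZero_prime_le_of_not_dvd` = `GS(q)`; `q ∣ r`:
`|κ(q)| ≤ 2 + B log q ≤ 2GS(q)`; `ν ≥ 2`: `gC(q^ν) ≤ 7(2+S₃)(ν+1)⁴ ≤ gS(q^ν) ≤ GS(q^ν)`), and
`ω_r(n) ≤ ω(r)`. [cite: Zhang2022LandauSiegel, §7 p.33; App. A pp.101–103] -/
theorem norm_xiZero_le_two_pow_mul_GS (j : ℕ) {d r n : ℕ} (hd : d ≠ 0) (hr : r ≠ 0) (hn : n ≠ 0) :
    ‖Skeleton.xiZero c' D j n d r‖ ≤ (2 : ℝ) ^ r.primeFactors.card * GS c' D n := by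
  -- the halved function
  set F : ℕ → ℝ := fun n =>
    ‖Skeleton.xiZero c' D j n d r‖ / (2 : ℝ) ^ (n.primeFactors.filter (fun q => q ∣ r)).card with hF
  have hF0 : ∀ n, 0 ≤ F n := fun n => by positivity
  have hF1 : F 1 = 1 := by
    simp only [hF, Lemma83.xiZero_apply_one, norm_one]
    simp
  have hFmul : ∀ m n, Nat.Coprime m n → F (m * n) = F m * F n := by
    intro m n hmn
    rcases Nat.eq_zero_or_pos m with rfl | hm
    · simp only [Nat.coprime_zero_left] at hmn
      subst hmn
      simp [hF, Lemma83.xiZero_apply_zero]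
    rcases Nat.eq_zero_or_pos n with rfl | hn'
    · simp only [Nat.coprime_zero_right] at hmn
      subst hmn
      simp [hF, Lemma83.xiZero_apply_zero]
    simp only [hF]
    rw [Lemma83.xiZero_mul_of_coprime c' D j hd hr hmn, norm_mul,
      card_pf_filter_dvd_mul r hmn hm.ne' hn'.ne', pow_add, mul_div_mul_comm]
  have hGmul : ∀ m n, Nat.Coprime m n → GS c' D (m * n) = GS c' D m * GS c' D n :=
    fun m n hmn => (isMultiplicative_GS c' D).map_mul_of_coprime hmn
  -- prime powers
  have hpow : ∀ q ν : ℕ, q.Prime → 0 < ν → F (q ^ ν) ≤ GS c' D (q ^ ν) := by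
    intro q ν hq hν
    have hq2 : (2 : ℝ) ≤ q := by exact_mod_cast hq.two_le
    have hlog0 : 0 ≤ Real.log q := Real.log_nonneg (by linarith)
    have hB := Bsum_nonneg c' D
    have hM : 0 ≤ Mx / (q : ℝ) := div_nonneg Mx_nonneg' (by linarith)
    rcases Nat.lt_or_ge ν 2 with hν1 | hν2
    · -- `ν = 1`
      obtain rfl : ν = 1 := by omega
      have hcard := card_pf_filter_dvd_prime_pow r hq one_ne_zero
      simp only [hF]
      rw [hcard, pow_one, GS_prime c' D hq]
      by_cases hqr : q ∣ r
      · rw [if_pos hqr, pow_one, div_le_iff₀ (by norm_num : (0 : ℝ) < 2)]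
        refine (norm_xiZero_prime_le_of_dvd c' D hq j (d := d) hqr).trans ?_
        unfold Mx at hM ⊢
        nlinarith [mul_nonneg hB hlog0]
      · rw [if_neg hqr, pow_zero, div_one]
        exact norm_xiZero_prime_le_of_not_dvd c' D hq j (d := d) hqr
    · -- `ν ≥ 2`: `F ≤ |ξ₀ⱼ| ≤ gC ≤ 7(2+S₃)(ν+1)⁴ ≤ C_x(ν+1)⁴ = gS ≤ GS`
      have hle : F (q ^ ν) ≤ ‖Skeleton.xiZero c' D j (q ^ ν) d r‖ :=
        div_le_self (norm_nonneg _) (one_le_pow₀ (by norm_num))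
      refine hle.trans ?_
      refine (norm_xiZero_le_gC c' D (pow_ne_zero ν hq.ne_zero) j d r).trans ?_
      refine (gC_prime_pow_le c' D hq ν).trans ?_
      refine le_trans ?_ (gS_le_GS_prime_pow c' D hq ν)
      rw [gS_prime_pow_two_le c' D hq hν2]
      exact mul_le_mul_of_nonneg_right Cx_bounds.1 (by positivity)
  have hFn := le_of_prime_pow_le hF0 (GS_nonneg c' D) hF1 (isMultiplicative_GS c' D).map_one
    hFmul hGmul hpow hn
  -- undo the halving
  have h2 : (0 : ℝ) < (2 : ℝ) ^ (n.primeFactors.filter (fun q => q ∣ r)).card := by positivity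
  have e : ‖Skeleton.xiZero c' D j n d r‖ =
      (2 : ℝ) ^ (n.primeFactors.filter (fun q => q ∣ r)).card * F n := by
    simp only [hF]; rw [mul_div_cancel₀ _ h2.ne']
  rw [e]
  exact mul_le_mul (pow_le_pow_right₀ (by norm_num) (card_pf_filter_dvd_le n hr)) hFn (hF0 n)
    (by positivity)


/-! ### Part 3. The logarithmic mean of the seed (exponent zero) -/

/-- The local series of `gS` converges at every prime. [cite: Zhang2022LandauSiegel, §7 p.33] -/
theorem summable_gS_local {p : ℕ} (hp : p.Prime) :
    Summable fun ν : ℕ => gS c' D (p ^ ν) / (p : ℝ) ^ ν := by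
  have hp2 : (2 : ℝ) ≤ p := by exact_mod_cast hp.two_le
  have hC := Cx_bounds.2.2
  have hg1 : 0 ≤ gS c' D p := gS_nonneg c' D p
  have hbound : ∀ ν : ℕ, gS c' D (p ^ ν) / (p : ℝ) ^ ν ≤
      (1 + gS c' D p + Cx) * (((ν : ℝ) + 3) ^ 4 * (1 / 2 : ℝ) ^ ν) := by
    intro ν
    have hppos : (0 : ℝ) < (p : ℝ) ^ ν := by positivity
    rw [div_le_iff₀ hppos]
    have h1 : (1 : ℝ) ≤ (1 / 2 : ℝ) ^ ν * (p : ℝ) ^ ν := by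
      rw [← mul_pow]; exact one_le_pow₀ (by linarith)
    have h3 : (1 : ℝ) ≤ ((ν : ℝ) + 3) ^ 4 := one_le_pow₀ (by linarith [Nat.cast_nonneg (α := ℝ) ν])
    have hval : gS c' D (p ^ ν) ≤ (1 + gS c' D p + Cx) * ((ν : ℝ) + 3) ^ 4 := by
      rcases Nat.lt_or_ge ν 2 with hν | hν
      · interval_cases ν
        · rw [pow_zero, (isMultiplicative_gS c' D).map_one]; nlinarith
        · rw [pow_one]; nlinarith
      · rw [gS_prime_pow_two_le c' D hp hν]
        have h4 : ((ν : ℝ) + 1) ^ 4 ≤ ((ν : ℝ) + 3) ^ 4 :=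
          pow_le_pow_left₀ (by positivity) (by linarith) 4
        nlinarith [mul_le_mul_of_nonneg_left h4 hC, pow_nonneg (by positivity : (0:ℝ) ≤ (ν:ℝ) + 3) 4]
    calc gS c' D (p ^ ν) ≤ (1 + gS c' D p + Cx) * ((ν : ℝ) + 3) ^ 4 := hval
      _ ≤ (1 + gS c' D p + Cx) * ((ν : ℝ) + 3) ^ 4 * ((1 / 2 : ℝ) ^ ν * (p : ℝ) ^ ν) :=
          le_mul_of_one_le_right (by positivity) h1
      _ = _ := by ring
  exact Summable.of_nonneg_of_le (fun ν => div_nonneg (gS_nonneg c' D _) (by positivity))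
    hbound ((LogEulerProduct.summable_tailConst 4).mul_left _)

/-- **The logarithmic mean of the seed has exponent zero**: for `X ≥ 2` with `21B·log X ≤ 1134π`
(true for `X ≤ 16P`, `D` large: `B ≤ 9π𝓛⁻⁹`),
`Σ_{e≤X} gS(e)/e ≤ exp(21B·log 4X + M_x + C_xS₄)` (`sum_div_le_gen` with `a = 0`).
[cite: Zhang2022LandauSiegel, §7 p.33] -/
theorem sum_gS_div_le {X : ℕ} (hX : 2 ≤ X) (hBX : 21 * Bsum c' D * Real.log X ≤ 1134 * π) :
    ∑ e ∈ Icc 1 X, gS c' D e / e ≤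
      Real.exp (21 * Bsum c' D * Real.log (4 * X) + Mx + Cx * LogEulerProduct.tailConst 4) := by
  have hB := Bsum_nonneg c' D
  have hC := Cx_bounds
  have hg := isMultiplicative_gS c' D
  have hmaj := sum_div_le_gen (f := fun n => gS c' D n) hg.map_one
    (fun m n hmn => hg.map_mul_of_coprime hmn) (gS_nonneg c' D) (a := 0) (d := 4)
    (K := 21 * Bsum c' D) (M := Mx) (C₅ := Cx) (by positivity) Mx_nonneg' hC.2.2 hX
    (fun p hp => summable_gS_local c' D hp)
    (fun p hp _ => by rw [gS_prime c' D hp]; push_cast; linarith)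
    (fun p ν hp hpX => by
      rcases Nat.lt_or_ge ν 2 with hν | hν
      · interval_cases ν
        · rw [pow_zero, hg.map_one]; norm_num; linarith [hC.2.1, Mx_nonneg', Real.pi_gt_three]
        · -- `gS(p) = 21B log p + M_x/p ≤ 1134π + M_x ≤ 16 C_x`
          rw [pow_one, gS_prime c' D hp]
          have hp2 : (2 : ℝ) ≤ p := by exact_mod_cast hp.two_le
          have hpX' : (p : ℝ) ≤ X := by exact_mod_cast hpX
          have hlogp : Real.log p ≤ Real.log X := Real.log_le_log (by linarith) hpX'
          have hlog0 : 0 ≤ Real.log p := Real.log_nonneg (by linarith)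
          have hMp : Mx / (p : ℝ) ≤ Mx := div_le_self Mx_nonneg' (by linarith)
          have hπ := Real.pi_pos.le
          push_cast
          nlinarith [mul_le_mul_of_nonneg_left hlogp (by positivity : (0:ℝ) ≤ 21 * Bsum c' D),
            hC.2.1, Mx_nonneg']
      · rw [gS_prime_pow_two_le c' D hp hν])
  simpa using hmaj

/-! ### Part 4. The three means of `GS = ζ ∗ gS` -/

omit c' D in
/-- Reindexing the multiples: `Σ_{n ≤ X, e ∣ n} F(n) = Σ_{m ≤ X/e} F(em)` (`e ≥ 1`). [folklore] -/
private theorem sum_filter_dvd_eq (X : ℕ) {e : ℕ} (he : 0 < e) (F : ℕ → ℝ) :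
    ∑ n ∈ (Icc 1 X).filter (fun n => e ∣ n), F n = ∑ m ∈ Icc 1 (X / e), F (e * m) := by
  symm
  refine Finset.sum_nbij (fun m => e * m) (fun m hm => ?_) (fun m₁ _ m₂ _ h => ?_)
    (fun n hn => ?_) (fun m _ => rfl)
  · rw [mem_Icc] at hm
    rw [mem_filter, mem_Icc]
    refine ⟨⟨Nat.mul_pos he hm.1, ?_⟩, dvd_mul_right e m⟩
    have h := (Nat.le_div_iff_mul_le he).mp hm.2
    rw [mul_comm]; exact h
  · exact Nat.eq_of_mul_eq_mul_left he h
  · rw [mem_coe, mem_filter, mem_Icc] at hn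
    obtain ⟨⟨hn1, hnX⟩, ⟨m, rfl⟩⟩ := hn
    refine ⟨m, ?_, rfl⟩
    rw [mem_coe, mem_Icc]
    constructor
    · rcases Nat.eq_zero_or_pos m with rfl | hm
      · simp at hn1
      · exact hm
    · rw [Nat.le_div_iff_mul_le he, mul_comm]; exact hnX

omit c' D in
/-- **Means of a divisor sum.** For `g ≥ 0` and a weight `w`, 
`Σ_{n≤X} (Σ_{e∣n} g(e)) w(n) = Σ_{e≤X} g(e) Σ_{m≤X/e} w(em)`. [folklore] -/
private theorem sum_divisorSum_mul_eq (X : ℕ) (g w : ℕ → ℝ) :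
    ∑ n ∈ Icc 1 X, (∑ e ∈ n.divisors, g e) * w n =
      ∑ e ∈ Icc 1 X, g e * ∑ m ∈ Icc 1 (X / e), w (e * m) := by
  calc ∑ n ∈ Icc 1 X, (∑ e ∈ n.divisors, g e) * w n
      = ∑ n ∈ Icc 1 X, ∑ e ∈ n.divisors, g e * w n := by
        refine sum_congr rfl fun n _ => by rw [sum_mul]
    _ = ∑ e ∈ Icc 1 X, ∑ n ∈ (Icc 1 X).filter (fun n => e ∣ n), g e * w n := by
        rw [sum_comm' (t' := Icc 1 X) (s' := fun e => (Icc 1 X).filter (fun n => e ∣ n))]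
        intro n e
        rw [mem_filter, mem_Icc, mem_Icc, Nat.mem_divisors]
        constructor
        · rintro ⟨⟨hn1, hnX⟩, hed, hn0⟩
          have he0 : 0 < e := Nat.pos_of_dvd_of_pos hed (by omega)
          exact ⟨⟨⟨hn1, hnX⟩, hed⟩, he0, le_trans (Nat.le_of_dvd (by omega) hed) hnX⟩
        · rintro ⟨⟨⟨hn1, hnX⟩, hed⟩, -, -⟩
          exact ⟨⟨hn1, hnX⟩, hed, by omega⟩
    _ = ∑ e ∈ Icc 1 X, g e * ∑ m ∈ Icc 1 (X / e), w (e * m) := by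
        refine sum_congr rfl fun e he => ?_
        rw [mul_sum, sum_filter_dvd_eq X (mem_Icc.mp he).1 (fun n => g e * w n)]

/-- `Σ_{m ≤ M} 1/√m ≤ 2√M`. [folklore] -/
private theorem sum_inv_sqrt_le' (M : ℕ) : ∑ m ∈ Icc 1 M, (1 : ℝ) / Real.sqrt m ≤ 2 * Real.sqrt M := by
  induction M with
  | zero => simp
  | succ M ih =>
    rw [Finset.sum_Icc_succ_top (Nat.succ_le_succ (Nat.zero_le M)), Nat.cast_succ]
    have hM0 : (0 : ℝ) ≤ M := Nat.cast_nonneg M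
    have h1 : 0 < Real.sqrt ((M : ℝ) + 1) := Real.sqrt_pos.mpr (by linarith)
    have hkey : 1 / Real.sqrt ((M : ℝ) + 1) ≤ 2 * (Real.sqrt ((M : ℝ) + 1) - Real.sqrt M) := by
      rw [div_le_iff₀ h1]
      have hsq1 : Real.sqrt ((M : ℝ) + 1) ^ 2 = (M : ℝ) + 1 := Real.sq_sqrt (by linarith)
      have hsq0 : Real.sqrt (M : ℝ) ^ 2 = (M : ℝ) := Real.sq_sqrt hM0
      have hle : Real.sqrt (M : ℝ) ≤ Real.sqrt ((M : ℝ) + 1) := Real.sqrt_le_sqrt (by linarith)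
      nlinarith [Real.sqrt_nonneg (M : ℝ), sq_nonneg (Real.sqrt ((M : ℝ) + 1) - Real.sqrt M)]
    linarith

/-- `Σ_{m ≤ M} 1/m ≤ 1 + log M` (`log 0 = 0`). [folklore] -/
private theorem sum_inv_le_one_add_log' (M : ℕ) : ∑ m ∈ Icc 1 M, (1 : ℝ) / m ≤ 1 + Real.log M := by
  rcases Nat.eq_zero_or_pos M with rfl | hM
  · simp
  · have e : ∑ m ∈ Icc 1 M, (1 : ℝ) / m = (harmonic M : ℝ) := by
      rw [harmonic_eq_sum_Icc]
      push_cast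
      exact sum_congr rfl fun m _ => by rw [one_div]
    rw [e]
    exact harmonic_le_one_add_log M

/-- **The three means of `GS`** from a bound `Σ_{e≤X} gS(e)/e ≤ A₀`:
`Σ_{n≤X} GS(n) ≤ A₀X`, `Σ_{n≤X} GS(n)/n ≤ A₀(1 + log X)`, `Σ_{n≤X} GS(n)/√n ≤ 2A₀√X`.
[cite: Zhang2022LandauSiegel, §7 p.33; §12 p.67] -/
theorem GS_means_of_seed {X : ℕ} {A₀ : ℝ} (hA : ∀ Y : ℕ, Y ≤ X → ∑ e ∈ Icc 1 Y, gS c' D e / e ≤ A₀) :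
    (∑ n ∈ Icc 1 X, GS c' D n ≤ A₀ * X) ∧
      (∑ n ∈ Icc 1 X, GS c' D n / n ≤ A₀ * (1 + Real.log X)) ∧
      (∑ n ∈ Icc 1 X, GS c' D n / Real.sqrt n ≤ 2 * A₀ * Real.sqrt X) := by
  have hg0 := gS_nonneg c' D
  have hA₀ : 0 ≤ A₀ := by have h0 := hA 0 (Nat.zero_le X); simpa using h0
  have hAX := hA X le_rfl
  refine ⟨?_, ?_, ?_⟩
  · -- plain sum: `Σ_e g(e)·⌊X/e⌋ ≤ X Σ_e g(e)/e`
    have e1 : ∑ n ∈ Icc 1 X, GS c' D n = ∑ n ∈ Icc 1 X, (∑ e ∈ n.divisors, gS c' D e) * (1 : ℝ) := by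
      refine sum_congr rfl fun n _ => by rw [GS_apply, mul_one]
    rw [e1, sum_divisorSum_mul_eq X (fun e => gS c' D e) (fun _ => (1 : ℝ))]
    calc ∑ e ∈ Icc 1 X, gS c' D e * ∑ m ∈ Icc 1 (X / e), (1 : ℝ)
        = ∑ e ∈ Icc 1 X, gS c' D e * ((X / e : ℕ) : ℝ) := by
          refine sum_congr rfl fun e _ => ?_
          rw [sum_const, Nat.card_Icc, nsmul_eq_mul, mul_one]
          simp
      _ ≤ ∑ e ∈ Icc 1 X, (X : ℝ) * (gS c' D e / e) := by
          refine sum_le_sum fun e he => ?_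
          have he0 : (0 : ℝ) < e := by exact_mod_cast (mem_Icc.mp he).1
          calc gS c' D e * ((X / e : ℕ) : ℝ) ≤ gS c' D e * ((X : ℝ) / e) :=
                mul_le_mul_of_nonneg_left Nat.cast_div_le (hg0 e)
            _ = (X : ℝ) * (gS c' D e / e) := by ring
      _ = (X : ℝ) * ∑ e ∈ Icc 1 X, gS c' D e / e := by rw [mul_sum]
      _ ≤ (X : ℝ) * A₀ := mul_le_mul_of_nonneg_left hAX (Nat.cast_nonneg X)
      _ = A₀ * X := mul_comm _ _
  · -- logarithmic mean
    have e1 : ∑ n ∈ Icc 1 X, GS c' D n / n =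
        ∑ n ∈ Icc 1 X, (∑ e ∈ n.divisors, gS c' D e) * ((1 : ℝ) / n) := by
      refine sum_congr rfl fun n _ => by rw [GS_apply, mul_one_div]
    rw [e1, sum_divisorSum_mul_eq X (fun e => gS c' D e) (fun n => (1 : ℝ) / n)]
    calc ∑ e ∈ Icc 1 X, gS c' D e * ∑ m ∈ Icc 1 (X / e), (1 : ℝ) / ((e * m : ℕ) : ℝ)
        = ∑ e ∈ Icc 1 X, gS c' D e / e * ∑ m ∈ Icc 1 (X / e), (1 : ℝ) / m := by
          refine sum_congr rfl fun e he => ?_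
          have inner : ∑ m ∈ Icc 1 (X / e), (1 : ℝ) / ((e * m : ℕ) : ℝ) =
              (1 / (e : ℝ)) * ∑ m ∈ Icc 1 (X / e), (1 : ℝ) / m := by
            rw [mul_sum]
            refine sum_congr rfl fun m _ => ?_
            push_cast
            rw [one_div_mul_one_div]
          rw [inner]; ring
      _ ≤ ∑ e ∈ Icc 1 X, gS c' D e / e * (1 + Real.log X) := by
          refine sum_le_sum fun e he => mul_le_mul_of_nonneg_left ?_
            (div_nonneg (hg0 e) (Nat.cast_nonneg e))
          refine (sum_inv_le_one_add_log' (X / e)).trans ?_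
          have hXe : X / e ≤ X := Nat.div_le_self X e
          rcases Nat.eq_zero_or_pos (X / e) with h0 | hpos
          · rw [h0, Nat.cast_zero, Real.log_zero]
            linarith [Real.log_natCast_nonneg X]
          · have h1 : (0 : ℝ) < ((X / e : ℕ) : ℝ) := by exact_mod_cast hpos
            have h2 : ((X / e : ℕ) : ℝ) ≤ (X : ℝ) := by exact_mod_cast hXe
            linarith [Real.log_le_log h1 h2]
      _ = (∑ e ∈ Icc 1 X, gS c' D e / e) * (1 + Real.log X) := by rw [sum_mul]
      _ ≤ A₀ * (1 + Real.log X) :=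
          mul_le_mul_of_nonneg_right hAX (by linarith [Real.log_natCast_nonneg X])
  · -- square-root mean
    have e1 : ∑ n ∈ Icc 1 X, GS c' D n / Real.sqrt n =
        ∑ n ∈ Icc 1 X, (∑ e ∈ n.divisors, gS c' D e) * ((1 : ℝ) / Real.sqrt n) := by
      refine sum_congr rfl fun n _ => by rw [GS_apply, mul_one_div]
    rw [e1, sum_divisorSum_mul_eq X (fun e => gS c' D e) (fun n => (1 : ℝ) / Real.sqrt n)]
    have hXe : ∀ e ∈ Icc 1 X, Real.sqrt ((X / e : ℕ) : ℝ) ≤ Real.sqrt X / Real.sqrt e := by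
      intro e he
      have he0 : (0 : ℝ) < e := by exact_mod_cast (mem_Icc.mp he).1
      rw [le_div_iff₀ (Real.sqrt_pos.mpr he0), ← Real.sqrt_mul (Nat.cast_nonneg _)]
      apply Real.sqrt_le_sqrt
      calc ((X / e : ℕ) : ℝ) * e ≤ (X : ℝ) / e * e :=
            mul_le_mul_of_nonneg_right Nat.cast_div_le he0.le
        _ = X := by field_simp
    calc ∑ e ∈ Icc 1 X, gS c' D e * ∑ m ∈ Icc 1 (X / e), (1 : ℝ) / Real.sqrt ((e * m : ℕ) : ℝ)
        = ∑ e ∈ Icc 1 X, gS c' D e / Real.sqrt e * ∑ m ∈ Icc 1 (X / e), (1 : ℝ) / Real.sqrt m := by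
          refine sum_congr rfl fun e he => ?_
          have inner : ∑ m ∈ Icc 1 (X / e), (1 : ℝ) / Real.sqrt ((e * m : ℕ) : ℝ) =
              (1 / Real.sqrt e) * ∑ m ∈ Icc 1 (X / e), (1 : ℝ) / Real.sqrt m := by
            rw [mul_sum]
            refine sum_congr rfl fun m _ => ?_
            push_cast
            rw [Real.sqrt_mul (Nat.cast_nonneg e), one_div_mul_one_div]
          rw [inner]; ring
      _ ≤ ∑ e ∈ Icc 1 X, gS c' D e / Real.sqrt e * (2 * (Real.sqrt X / Real.sqrt e)) := by
          refine sum_le_sum fun e he => mul_le_mul_of_nonneg_left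
            ((sum_inv_sqrt_le' (X / e)).trans (by linarith [hXe e he])) ?_
          exact div_nonneg (hg0 e) (Real.sqrt_nonneg _)
      _ = ∑ e ∈ Icc 1 X, (2 * Real.sqrt X) * (gS c' D e / e) := by
          refine sum_congr rfl fun e he => ?_
          have he0 : (0 : ℝ) < e := by exact_mod_cast (mem_Icc.mp he).1
          have hse : Real.sqrt e * Real.sqrt e = e := Real.mul_self_sqrt he0.le
          have hse0 : Real.sqrt e ≠ 0 := (Real.sqrt_pos.mpr he0).ne'
          field_simp
          rw [Real.sq_sqrt he0.le]
          ring
      _ = (2 * Real.sqrt X) * ∑ e ∈ Icc 1 X, gS c' D e / e := by rw [mul_sum]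
      _ ≤ (2 * Real.sqrt X) * A₀ := mul_le_mul_of_nonneg_left hAX (by positivity)
      _ = 2 * A₀ * Real.sqrt X := by ring


/-! ### Part 5. The bookkeeping in `D`: absolute constants on `X ≤ 4P` -/

/-- The absolute constant `E_S = exp(1134π + M_x + C_xS₄)` bounding the seed's logarithmic
mean on `X ≤ 4P` for `D ≥ D₀(c′)`. [cite: Zhang2022LandauSiegel, §7 p.33] -/
def ES : ℝ := Real.exp (1134 * π + Mx + Cx * LogEulerProduct.tailConst 4)

/-- `0 < E_S`. [cite: Zhang2022LandauSiegel, §7 p.33] -/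
theorem ES_pos : 0 < ES := Real.exp_pos _

/-- **Seed mean on `X ≤ 4P`.** For `D ≥ ⌈exp(5|c′|π+3)⌉` (so `𝓛 ≥ 3`, `B ≤ 9π𝓛⁻⁹`) and every
`X ≤ 4P`: `Σ_{e≤X} gS(e)/e ≤ E_S`. [cite: Zhang2022LandauSiegel, §7 p.33] -/
theorem sum_gS_div_le_ES {c' : ℝ} {D : ℕ} (hD : ⌈Real.exp (5 * |c'| * π + 3)⌉₊ ≤ D) {X : ℕ}
    (hXP : (X : ℝ) ≤ 4 * Skeleton.bigP D) : ∑ e ∈ Icc 1 X, gS c' D e / e ≤ ES := by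
  rcases Nat.lt_or_ge X 2 with hX | hX
  · have hE1 : 1 ≤ ES := Real.one_le_exp (by
      have := Mx_nonneg'; have := Cx_bounds.2.2; have := LogEulerProduct.tailConst_nonneg 4
      have := Real.pi_pos.le; positivity)
    interval_cases X
    · simp [ES_pos.le]
    · rw [show Icc 1 1 = {1} by rfl, sum_singleton, (isMultiplicative_gS c' D).map_one]
      simpa using hE1
  obtain ⟨hL3, hBle⟩ := three_le_ell_and_Bsum_le hD
  set ℓ := Skeleton.ell D with hℓ
  have hB := Bsum_nonneg c' D
  have hX2 : (2 : ℝ) ≤ X := by exact_mod_cast hX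
  have hP : Skeleton.bigP D = Real.exp (ℓ ^ 9) := rfl
  have hℓ9 : (3 : ℝ) ^ 9 ≤ ℓ ^ 9 := pow_le_pow_left₀ (by norm_num) hL3 9
  have hlog16 : Real.log 16 ≤ 3 := by
    have : (16 : ℝ) ≤ Real.exp 3 := by
      have h27 : (2.7 : ℝ) < Real.exp 1 := lt_trans (by norm_num) Real.exp_one_gt_d9
      have h3 : Real.exp 3 = Real.exp 1 ^ 3 := by rw [← Real.exp_nat_mul]; norm_num
      have hp : (2.7 : ℝ) ^ 3 < Real.exp 1 ^ 3 := pow_lt_pow_left₀ h27 (by norm_num) (by norm_num)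
      rw [h3]; norm_num at hp; linarith
    calc Real.log 16 ≤ Real.log (Real.exp 3) := Real.log_le_log (by norm_num) this
      _ = 3 := Real.log_exp 3
  have hlog4X : Real.log (4 * X) ≤ 6 * ℓ ^ 9 := by
    have h16P : (4 : ℝ) * X ≤ 16 * Skeleton.bigP D := by linarith
    calc Real.log (4 * X) ≤ Real.log (16 * Skeleton.bigP D) := Real.log_le_log (by linarith) h16P
      _ = Real.log 16 + ℓ ^ 9 := by
          rw [hP, Real.log_mul (by norm_num) (Real.exp_pos _).ne', Real.log_exp]
      _ ≤ 6 * ℓ ^ 9 := by norm_num at hℓ9; linarith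
  have hlogX : Real.log X ≤ Real.log (4 * X) := Real.log_le_log (by linarith) (by linarith)
  have hKlog : 21 * Bsum c' D * Real.log (4 * X) ≤ 1134 * π := by
    have hl9pos : 0 < ℓ ^ 9 := by positivity
    have hlog4X0 : 0 ≤ Real.log (4 * X) := Real.log_nonneg (by linarith)
    calc 21 * Bsum c' D * Real.log (4 * X) ≤ 21 * (9 * π / ℓ ^ 9) * (6 * ℓ ^ 9) :=
          mul_le_mul (mul_le_mul_of_nonneg_left hBle (by norm_num)) hlog4X hlog4X0
            (by positivity)
      _ = 1134 * π := by field_simp; ring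
  have hKlogX : 21 * Bsum c' D * Real.log X ≤ 1134 * π :=
    le_trans (mul_le_mul_of_nonneg_left hlogX (by positivity)) hKlog
  refine (sum_gS_div_le c' D hX hKlogX).trans (Real.exp_le_exp.mpr ?_)
  linarith

/-- **The three means of `GS` on `X ≤ 4P` with absolute constants.** For
`D ≥ ⌈exp(5|c′|π+3)⌉` and `X ≤ 4P`:
`Σ_{n≤X} GS(n) ≤ E_S·X`, `Σ_{n≤X} GS(n)/n ≤ E_S(1 + log X)`, `Σ_{n≤X} GS(n)/√n ≤ 2E_S√X`.
[cite: Zhang2022LandauSiegel, §7 p.33; §12 p.67] -/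
theorem GS_means_ell {c' : ℝ} {D : ℕ} (hD : ⌈Real.exp (5 * |c'| * π + 3)⌉₊ ≤ D) {X : ℕ}
    (hXP : (X : ℝ) ≤ 4 * Skeleton.bigP D) :
    (∑ n ∈ Icc 1 X, GS c' D n ≤ ES * X) ∧
      (∑ n ∈ Icc 1 X, GS c' D n / n ≤ ES * (1 + Real.log X)) ∧
      (∑ n ∈ Icc 1 X, GS c' D n / Real.sqrt n ≤ 2 * ES * Real.sqrt X) :=
  GS_means_of_seed c' D fun _ hY =>
    sum_gS_div_le_ES hD ((Nat.cast_le.mpr hY).trans hXP)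

end Literature.NumberTheory.LFunctions.Zhang2022.XiZeroMajorant
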